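import Summits.Ventures.PercRepro.Night2LocalThmEFinal

/-!
# PercRepro — an INJECTION of the members into the spanning sets certifies the local form (night-2, gen 9)

Let `G` be a rank-`(q+1)` flat of a finite matroid `M`.  Suppose the members below `G` (the bottom sets
`B` with `cl B ⊆ G`) INJECT into the shadow sets with closure `G` by containment: an injective map
`ι` with `B ⊆ ι B`, `ι B` a spanning subset of `G`.  Then the local form (LI_G) holds, by the explicit
fractional matching

  `w(B, S) = 1/((q+1)(q+2))` on every covering set `S = B ∪ {z}` (`z ∈ G ∖ cl B`)  +  `(q+1)/(q+2)` on `S = ι B`.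

Rows: with `m = |G ∖ cl B|` and `d = |E ∖ G| ≥ 1` the demand is `Φ·m/(m+d) ≤ Φ·m/(m+1)` and the income is
`m/((q+1)(q+2)) + (q+1)/(q+2)`; the difference is `(m − q − 1)²/((q+1)(q+2)(m+1)) ≥ 0`.
Columns: a shadow set has at most `q + 1` covering preimages (`card_coverPreimages_le`) and at most one
`ι`-preimage, so the load is `≤ (q+1)/((q+1)(q+2)) + (q+1)/(q+2) = 1`.

Numbers (NIGHT-2-local.md §18, this gen): at `|E ∖ G| = 1` the restriction `M|G` has at most one coloop,
with one coloop every member is a layer-0 member (`localShadowHall_of_all_lay0`), and for coloop-free `M|G`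
such an injection exists — even into the exact traces `B ∪ Z`, `Z ⊆ G ∖ cl B`, `|Z| ≤ 2` — on every flat of
the loopless catalogue ≤ 8 elements (251 flats) and on 135 random GF(2)/GF(3)/GF(5) matroids ≤ 12 elements.
The injection statement (INJ-d1) is the lane's open statement for the regime `|E ∖ G| = 1`.
-/

namespace PercRepro.Shadow

open Finset PerFlat ThmH

variable {α : Type*} [DecidableEq α] {M : Matroid α} [M.Finite]

/-- The covering part of the matching (`1/((q+1)(q+2))` on each covering set) is nonnegative. -/
theorem covPart_nonneg (q : ℕ) (G B S : Finset α) : 0 ≤ (if S ∈ coverSets M B G then 1 / (((q : ℚ) + 1) * ((q : ℚ) + 2)) else 0) := by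
  split_ifs
  · positivity
  · exact le_rfl

/-- The injection part of the matching (`(q+1)/(q+2)` on `ι B`) is nonnegative. -/
theorem injPart_nonneg (q : ℕ) (G : Finset α) (ι : Finset α → Finset α) (B S : Finset α) :
    0 ≤ (if B ∈ membersIn M (Uq M (q + 2) q) G ∧ S = ι B then ((q : ℚ) + 1) / ((q : ℚ) + 2) else 0) := by
  split_ifs
  · positivity
  · exact le_rfl

open scoped Classical in
/-- The column sum of the covering part is `#coverPreimages / ((q+1)(q+2))`. -/
theorem sum_covPart_col (q : ℕ) (G S : Finset α) :
    ∑ B ∈ membersIn M (Uq M (q + 2) q) G, (if S ∈ coverSets M B G then 1 / (((q : ℚ) + 1) * ((q : ℚ) + 2)) else 0) =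
      ((coverPreimages M (Uq M (q + 2) q) G S).card : ℚ) / (((q : ℚ) + 1) * ((q : ℚ) + 2)) := by
  unfold coverPreimages
  rw [← Finset.sum_filter, Finset.sum_const, nsmul_eq_mul]
  ring

open scoped Classical in
/-- The row sum of the covering part over the shadow at `G` is `|G ∖ cl B| / ((q+1)(q+2))`. -/
theorem sum_covPart_row {q : ℕ} {G : Finset α} (hG : G ∈ flatsQ M (q + 1)) {B : Finset α}
    (hB : B ∈ membersIn M (Uq M (q + 2) q) G) :
    ∑ S ∈ shadowAt M (q + 2) q (Uq M (q + 2) q) G, (if S ∈ coverSets M B G then 1 / (((q : ℚ) + 1) * ((q : ℚ) + 2)) else 0) =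
      ((G \ clF M B).card : ℚ) / (((q : ℚ) + 1) * ((q : ℚ) + 2)) := by
  have hBU : B ∈ Uq M (q + 2) q := (mem_membersIn.1 hB).1
  have hsub : coverSets M B G ⊆ shadowAt M (q + 2) q (Uq M (q + 2) q) G :=
    coverSets_subset_shadowAt (Finset.Subset.refl _) hG hB
  rw [← Finset.sum_filter, Finset.filter_mem_eq_inter, Finset.inter_eq_right.2 hsub, Finset.sum_const,
    card_coverSets hBU, nsmul_eq_mul]
  ring

open scoped Classical in
/-- The column sum of the injection part is at most `(q+1)/(q+2)` when `ι` is injective on the members. -/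
theorem sum_injPart_col_le {q : ℕ} {G : Finset α} {ι : Finset α → Finset α}
    (hinj : Set.InjOn ι (membersIn M (Uq M (q + 2) q) G : Set (Finset α))) (S : Finset α) :
    ∑ B ∈ membersIn M (Uq M (q + 2) q) G, (if B ∈ membersIn M (Uq M (q + 2) q) G ∧ S = ι B then ((q : ℚ) + 1) / ((q : ℚ) + 2) else 0) ≤ ((q : ℚ) + 1) / ((q : ℚ) + 2) := by
  rw [← Finset.sum_filter]
  have hcard : ((membersIn M (Uq M (q + 2) q) G).filter
      (fun B => B ∈ membersIn M (Uq M (q + 2) q) G ∧ S = ι B)).card ≤ 1 := by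
    rw [Finset.card_le_one]
    intro B hB B' hB'
    rw [Finset.mem_filter] at hB hB'
    exact hinj hB.1 hB'.1 (hB.2.2.symm.trans hB'.2.2)
  rw [Finset.sum_const, nsmul_eq_mul]
  have hpos : (0 : ℚ) ≤ ((q : ℚ) + 1) / ((q : ℚ) + 2) := by positivity
  calc (((membersIn M (Uq M (q + 2) q) G).filter
        (fun B => B ∈ membersIn M (Uq M (q + 2) q) G ∧ S = ι B)).card : ℚ) * (((q : ℚ) + 1) / ((q : ℚ) + 2))
      ≤ 1 * (((q : ℚ) + 1) / ((q : ℚ) + 2)) := by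
        apply mul_le_mul_of_nonneg_right _ hpos
        exact_mod_cast hcard
    _ = ((q : ℚ) + 1) / ((q : ℚ) + 2) := one_mul _

open scoped Classical in
/-- The row sum of the injection part of a member `B` is exactly `(q+1)/(q+2)` when `ι B` is a shadow set. -/
theorem sum_injPart_row {q : ℕ} {G : Finset α} {ι : Finset α → Finset α} {B : Finset α}
    (hB : B ∈ membersIn M (Uq M (q + 2) q) G) (hιB : ι B ∈ shadowAt M (q + 2) q (Uq M (q + 2) q) G) :
    ∑ S ∈ shadowAt M (q + 2) q (Uq M (q + 2) q) G, (if B ∈ membersIn M (Uq M (q + 2) q) G ∧ S = ι B then ((q : ℚ) + 1) / ((q : ℚ) + 2) else 0) = ((q : ℚ) + 1) / ((q : ℚ) + 2) := by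
  rw [← Finset.sum_filter]
  have hfilt : (shadowAt M (q + 2) q (Uq M (q + 2) q) G).filter
      (fun S => B ∈ membersIn M (Uq M (q + 2) q) G ∧ S = ι B) = {ι B} := by
    ext S
    rw [Finset.mem_filter, Finset.mem_singleton]
    constructor
    · rintro ⟨-, -, rfl⟩; rfl
    · rintro rfl; exact ⟨hιB, hB, rfl⟩
  rw [hfilt, Finset.sum_singleton]

omit [DecidableEq α] [M.Finite] in
/-- The arithmetic of the rows: `m/((q+1)(q+2)) + (q+1)/(q+2) ≥ (q+2)/(q+1) · m/(m+1)`. -/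
theorem row_arith (q m : ℕ) :
    (((q : ℚ) + 2) / ((q : ℚ) + 1)) * ((m : ℚ) / ((m : ℚ) + 1)) ≤
      (m : ℚ) / (((q : ℚ) + 1) * ((q : ℚ) + 2)) + ((q : ℚ) + 1) / ((q : ℚ) + 2) := by
  have hq1 : (0 : ℚ) < (q : ℚ) + 1 := by positivity
  have hq2 : (0 : ℚ) < (q : ℚ) + 2 := by positivity
  have hm1 : (0 : ℚ) < (m : ℚ) + 1 := by positivity
  rw [div_mul_div_comm, div_add_div _ _ (by positivity) (by positivity), div_le_div_iff₀ (by positivity) (by positivity)]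
  nlinarith [sq_nonneg ((m : ℚ) - (q : ℚ) - 1), hq1, hq2, hm1, mul_pos hq1 hq2, mul_pos (mul_pos hq1 hq2) hm1]

open scoped Classical in
/-- The local weight of a member is at most `m/(m+1)`, `m = |G ∖ cl B|` (there is an element outside `G`). -/
theorem localWeight_le {q : ℕ} {G : Finset α} (hG : G ∈ flatsQ M (q + 1)) {B : Finset α}
    (hB : B ∈ membersIn M (Uq M (q + 2) q) G) :
    localWeight M B G ≤ ((G \ clF M B).card : ℚ) / (((G \ clF M B).card : ℚ) + 1) := by
  have hBU : B ∈ Uq M (q + 2) q := (mem_membersIn.1 hB).1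
  have hBG : clF M B ⊆ G := (mem_membersIn.1 hB).2
  have hadd := card_compl_clF_add hG hBG
  have hd : 1 ≤ (gr M \ G).card := one_le_card_compl_of_member hG hBU
  unfold localWeight
  rw [hadd]
  push_cast
  have hm : (0 : ℚ) ≤ ((G \ clF M B).card : ℚ) := by positivity
  have hd' : (1 : ℚ) ≤ ((gr M \ G).card : ℚ) := by exact_mod_cast hd
  apply div_le_div_of_nonneg_left hm (by positivity)
  linarith

open scoped Classical in
/-- **An injection of the members into the shadow certifies the local form.**  If `ι` sends every member
`B` below `G` to a shadow set `ι B ⊇ B` with closure `G`, injectively, then (LI_G) holds at `G`. -/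
theorem localShadowHall_of_injection {q : ℕ} {G : Finset α} (hG : G ∈ flatsQ M (q + 1))
    (ι : Finset α → Finset α)
    (hι : ∀ B ∈ membersIn M (Uq M (q + 2) q) G, ι B ∈ shadowAt M (q + 2) q (Uq M (q + 2) q) G)
    (hsub : ∀ B ∈ membersIn M (Uq M (q + 2) q) G, B ⊆ ι B)
    (hinj : Set.InjOn ι (membersIn M (Uq M (q + 2) q) G : Set (Finset α))) :
    LocalShadowHall M q G := by
  apply localShadowHall_of_full_matching (fun B S => (if S ∈ coverSets M B G then 1 / (((q : ℚ) + 1) * ((q : ℚ) + 2)) else 0) + (if B ∈ membersIn M (Uq M (q + 2) q) G ∧ S = ι B then ((q : ℚ) + 1) / ((q : ℚ) + 2) else 0))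
  · intro B S
    exact add_nonneg (covPart_nonneg q G B S) (injPart_nonneg q G ι B S)
  · intro B S h
    by_contra hBS
    apply h
    have h1 : (if S ∈ coverSets M B G then 1 / (((q : ℚ) + 1) * ((q : ℚ) + 2)) else 0) = 0 := by
      rw [if_neg]
      intro hS
      obtain ⟨z, -, rfl⟩ := mem_coverSets.1 hS
      exact hBS (Finset.subset_insert _ _)
    have h2 : (if B ∈ membersIn M (Uq M (q + 2) q) G ∧ S = ι B then ((q : ℚ) + 1) / ((q : ℚ) + 2) else 0) = 0 := by
      rw [if_neg]
      rintro ⟨hB, rfl⟩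
      exact hBS (hsub B hB)
    rw [h1, h2, add_zero]
  · intro S hS
    rw [Finset.sum_add_distrib, sum_covPart_col]
    have hc : (coverPreimages M (Uq M (q + 2) q) G S).card ≤ q + 1 :=
      card_coverPreimages_le (Finset.Subset.refl _) hS
    have hc' : ((coverPreimages M (Uq M (q + 2) q) G S).card : ℚ) ≤ (q : ℚ) + 1 := by exact_mod_cast hc
    have hi := sum_injPart_col_le hinj S
    have hq2 : (0 : ℚ) < (q : ℚ) + 2 := by positivity
    have hq1 : (0 : ℚ) < (q : ℚ) + 1 := by positivity
    calc ((coverPreimages M (Uq M (q + 2) q) G S).card : ℚ) / (((q : ℚ) + 1) * ((q : ℚ) + 2)) +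
          ∑ B ∈ membersIn M (Uq M (q + 2) q) G, (if B ∈ membersIn M (Uq M (q + 2) q) G ∧ S = ι B then ((q : ℚ) + 1) / ((q : ℚ) + 2) else 0)
        ≤ ((q : ℚ) + 1) / (((q : ℚ) + 1) * ((q : ℚ) + 2)) + ((q : ℚ) + 1) / ((q : ℚ) + 2) := by
          gcongr
      _ = 1 := by field_simp; ring
  · intro B hB
    rw [Finset.sum_add_distrib, sum_covPart_row hG hB, sum_injPart_row hB (hι B hB)]
    calc (((q : ℚ) + 2) / ((q : ℚ) + 1)) * localWeight M B G
        ≤ (((q : ℚ) + 2) / ((q : ℚ) + 1)) *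
            (((G \ clF M B).card : ℚ) / (((G \ clF M B).card : ℚ) + 1)) := by
          apply mul_le_mul_of_nonneg_left (localWeight_le hG hB) (by positivity)
      _ ≤ ((G \ clF M B).card : ℚ) / (((q : ℚ) + 1) * ((q : ℚ) + 2)) + ((q : ℚ) + 1) / ((q : ℚ) + 2) :=
          row_arith q _

end PercRepro.Shadow
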